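import Mathlib
import HarnessLib
import Summits.CriticalPhenomena.SAWScalingLimit.Theses.SAWRenewalTightness
import Summits.CriticalPhenomena.SAWScalingLimit.Theorems.SAWRenewalTightnessShellCrossingBoundTravCount
import Summits.CriticalPhenomena.SAWScalingLimit.Theorems.SAWRenewalTightnessShellCrossingBoundSocketedEnlargement
import Summits.CriticalPhenomena.SAWScalingLimit.Theorems.SAWRenewalTightnessShellCrossingBoundSocketTransfer
import Summits.CriticalPhenomena.SAWScalingLimit.Theorems.ShellCrossingBound.Negative.UniformThresholdFalse
import Summits.CriticalPhenomena.SAWScalingLimit.Theorems.ShellCrossingBound.Negative.OfEventualTight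
import Literature.Probability.RandomPlanarGeometry.CurveTortuosity
import Literature.Probability.RandomPlanarGeometry.PinchUnionBound
import Literature.Probability.RandomPlanarGeometry.SAWRestrictionCovariance

/-!
# Line `pinch-on-a-circle` for the crux `SAWRenewalTightness.ShellCrossingBound` (stmt-CriticalPhenomena-4728)

Lead skeleton, reshape v-c2 (lead seat `prover-line-stmt-CriticalPhenomena-4728-c2-0`, 2026-08-16) of
reshape v-c1.1 (co-lead `…-c1-0`) of the crux-plan skeleton `Cruxes/ShellCrossingBound/Lines/pinch-on-a-circle.lean`
(planner `cruxplan-stmt-CriticalPhenomena-4728-pinch-on-a-circle`; idea cards `Ideas/pinch-on-a-circle.md` +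
`Ideas/socket-comparison.md`; triage `TRIAGE-r1-{1,2,3}.md`, 3 × pass).  Published as
`Lines/pinch_on_a_circle_c2.lean` (c1-0's `Lines/pinch_on_a_circle.lean` is left untouched).

## Reshape v-c2 in one paragraph (what changed against v-c1.1, and why)

ONE registered open stub: S0 `stub_pinchAway` (= `PinchAwayAll` below = seat -0's S0 text, re-registered
verbatim and additively on 2026-08-16T13:5xZ).  The composition `ShellCrossingBound_of (hS0)` is LANDED glue
only — and that glue now also lives in the tree as an importable Theorems file,
`Theorems/SAWRenewalTightnessShellCrossingBoundOfPinchAway.lean` (`Theorems.shellCrossingBound_of_pinchAway :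
S0-text → ShellCrossingBound`, registered glue stub of the same name, proposal p107371; §2 below is its
in-file twin, kept so that this workfile elaborates before the farm has built the new module).  The v-c1.1
stubs E `stub_confinementPositivity` and F `stub_bulkTwoStrandPinch` are NOT dropped: they stay registered
(c1-0) and appear below as the SUB-LINE `pinchAwayAll_of_EF : E → F → S0` (= the landed
`Theorems.stub_socketTransfer` fed with the landed `Theorems.stub_socketedEnlargement`), i.e. one of the two
landed descents from S0 (the other is seat -0's `S0 ⇐ S4 ∧ S5`, `Lines/socket_comparison.lean`).  Why hand
back S0 rather than F: F alone does not close the crux (E is open too), S0 does, and every attacker of S0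
can descend to E ∧ F or to S4 ∧ S5 by landed theorems at no cost.  `wave: none` — S0 is the single open
stub and is held by the lead; E and F were audited by c1-0's wave 1 (E ⟺ partition-ratio positivity,
p103341; E ⟸ summit, p105757; F crux-sized, `LeadPinchOnACircle.md`).

## The line in one paragraph (v-c1.1 text, still exact)

The crux lets the traversal threshold `k x ρ R` depend on the shell, so it follows from PER-SHELL DECAY of
the traversal count (shell-dependent threshold AND shell-dependent mesh bound), the coarse meshes being
free by the LANDED counting bound `Theorems.stub_travCount` (seat -0, p81647): `bound_of_perShellDecay`
below, `K = 1`, `λ = 3`, global `δ₀ = 1`.  Per-shell decay follows from the two-strand pinch bound AWAY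
FROM THE MARKED POINTS in the original domain (`PinchAwayAll`: fixed threshold FOUR, any exponent
`1 + s > 1`, centres `d`-away from `a, b`) by pigeonhole on the middle circle and a union bound over a
ONE-dimensional net — the LANDED `perShellDecay_of_pinchBound` (Literature `PinchUnionBound.lean`,
p90167, built on `Curve.exists_pinch_of_hasTraversals`, `CurvePinch.lean`, p89577).  Socket comparison
then quarantines the boundary: by exact restriction covariance of the `x_c`-law (LANDED
`SAW.law_mul_law_setOf_exists_support_eq_le`, p88835), `PinchAwayAll` for an arbitrary Jordan domain `D`
follows from the two-strand bound at INTERIOR balls of a socketed enlargement `D̂ ⊇ D`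
(`stub_socketedEnlargement`, Schoenflies) divided by one rate-free confinement constant
(`stub_socketTransfer`).  What is left open is named and typed: `stub_bulkTwoStrandPinch` (the
interior 4-leg / two-pinch bound for the critical `ℤ²` SAW with exponent `> 1`; predicted `x₄ = 35/12`;
HARDEST) and `stub_confinementPositivity` (the critical SAW of the big domain is a walk of the socketed
sub-domain with probability `≥ c > 0`; predicted value the SLE₈⸝₃ restriction constant; rate-free).

  ShellCrossingBound
    ⇐ ∀ (D,a,b), PerShellDecay                        (bound_of_perShellDecay + Theorems.stub_travCount, PROVED/LANDED)
    ⇐ PinchAwayAll                                    (pinchAwayAll_perShellDecay: landed perShellDecay_of_pinchBound)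
    ⇐ SocketedEnlargement ∧ ConfinementPositivity ∧ BulkTwoStrandPinch
                                                      (stub_socketTransfer; stub_socketedEnlargement,
                                                       stub_confinementPositivity, stub_bulkTwoStrandPinch)

`ShellCrossingBound_of` (no `sorry`) composes the four registered stubs and concludes the crux BY NAME;
`sorry` occurs only inside `stub_*`.  Hypotheses of `ShellCrossingBound_of` are the name-keyed aliases
`Registered.stub_*`.  Every stub is stated over TREE VOCABULARY ONLY (no local `def` inside a registered
signature), so each lands verbatim as `Theorems/SAWRenewalTightnessShellCrossingBound<Stub>.lean
--supports stmt-CriticalPhenomena-4728` without importing this workfile; the `*_holds` lemmas certify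
definitionally that the named statements ARE the registered texts.

## Reshape v-c1 versus the planner's skeleton (6 stubs → 4 stubs, same composition idea)

* stubs A `stub_subMeshNoPinch` and B `stub_pinchUnion` are DROPPED: seat -0's landed glue
  (`perShellDecay_of_pinchBound` + `stub_travCount`) already gives crux ⇐ `PinchAway` with a
  shell-dependent mesh bound, so neither the global-`δ₀` form `PerShellTight` nor sub-mesh emptiness is
  needed;
* stub D is retargeted to conclude `PinchAwayAll` = seat -0's registered S0 text (`stub_pinchAway`),
  verbatim;
* stub F gains the mesh clause `δ ≤ η` (weaker, hence safer; all the composition uses);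
* stub E is typed on the support-form confinement event `{γ | ∃ γ' : DomainSAW D' δ …, γ'.support =
  γ.support}` of the landed restriction lemma (equivalent to the planner's edge event `staysIn`: all
  edges of `γ` are edges of `D'_δ` iff `γ.walk.transfer` is a `D'_δ`-walk with the same support).

## LEAD STATUS, seat c2-0, reshape v-c2 (2026-08-16; details `Cruxes/ShellCrossingBound/LeadPinchOnACircleC2.md`)

* S0 `stub_pinchAway` — OPEN, the one open stub (lead): crux-sized; `promote-stub: stub_pinchAway`.
* glue `shellCrossingBound_of_pinchAway` (S0-text → crux by name) — LANDED as a Theorems file (p107371).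
* sub-line E, F (c1-0's registered stubs) — OPEN, audited (below); `pinchAwayAll_of_EF` landed glue.

## LEAD STATUS of co-lead c1-0 after its cycle 1 (details `Cruxes/ShellCrossingBound/LeadPinchOnACircle.md`)

* C `stub_socketedEnlargement` — CLOSED, LANDED p97679 (`Theorems.stub_socketedEnlargement`).
* D `stub_socketTransfer` — CLOSED, LANDED p98857 (`Theorems.stub_socketTransfer`).
* E `stub_confinementPositivity` — OPEN; audited: ⟺ partition-ratio positivity
  (`Theorems.confinementPositivity_iff_partitionRatio`, p103341) and ⟸ `SAWScalingLimit` ∧ SLE₈⸝₃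
  hull-avoidance positivity (`Theorems.confinementPositivity_of_scalingLimit`, p105757: summit-safe);
  exact identity `law_D(Conf D') = Z_{D'}/Z_D` landed as Literature (p100185).
* F `stub_bulkTwoStrandPinch` — OPEN, hardest (lead): crux-sized (see the status file for the surgery
  exponent bookkeeping); recommendation `promote-stub: F`.
* `ShellCrossingBound_of_EF (hE) (hF)` below: with E ∧ F the crux closes by LANDED glue alone.

## Disproof used (`Cruxes/ShellCrossingBound/Disproof.lean`, cdisprove cycles 1–2; landed `Negative/*` imported above)

* No `_false_without_<H>` theorem exists for this crux (it RESISTS: `shellCrossingBound_iff_eventualTight`,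
  `Negative/OfEventualTight.lean`).  The line puts content back by FIXING the threshold: `k = 4`
  (`BulkTwoStrandPinch`), not via `T′`.
* `Negative.not_uniformThreshold` (`UniformThresholdFalse.lean`, witness `Forcing.forcingDomain`: shells
  forced near the marked point `a = 0`): no stub is an instance — `BulkTwoStrandPinch` only speaks of
  balls `closedBall y (2R) ⊆ Ω`, `PinchAwayAll` keeps centres at distance `≥ d` from BOTH marked points
  with `C, s, R₀, δ₁` depending on `d`.
* Cycle 2, `Negative/BulkThresholdTwo.lean` (`Bulk.not_bulkThreshold_of_le_two`: a fixed bulk threshold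
  `k₀ ≤ 2` is FALSE by the interior-endpoint grid witness): honoured — the fixed threshold here is `4`;
  the guarded statement `PinchAwayAll` absorbs interior endpoints in `C(d)` (Disproof §5b, "ALTERNATIVE
  REPAIR … the interior-endpoint witness is then absorbed").
* Negatives index: stmt-0772 (all-`δ` tightness) — every statement here keeps `δ ≤ δ₀`.
-/

noncomputable section

open MeasureTheory Set Metric
open scoped ENNReal
open Literature.Probability.RandomPlanarGeometry Literature.Probability.LatticeModels
open Summit.CriticalPhenomena.SAWScalingLimit.Theses.SAWRenewalTightness (ShellCrossingBound)

namespace Summit.CriticalPhenomena.SAWScalingLimit.Cruxes.ShellCrossingBound.PinchOnACircle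

/-! ## §0 Vocabulary of the line (named `Prop`s; the registered stubs below restate them verbatim) -/

/-- **Socketed enlargement with room** (STUB C's statement; the geometric lemma of card
socket-comparison, made exact): every Dobrushin domain `D` sits inside a Dobrushin domain `D'` with the
SAME marked points, coinciding with `D` inside the socket balls of radius `d/2`, and containing a UNIFORM
collar `closedBall z ε` around every point `z ∈ closure D` at distance `≥ d` from both marked points.
Construction (provable now): Schoenflies homeomorphism `H : ℂ ≃ₜ ℂ` with `H(𝔻) = D`, `H(∂𝔻) = ∂D`
(`JordanDomain.exists_homeomorph_eqOn_frontier` with `unitDisc`); `K := H⁻¹(S) ∩ {1 ≤ ‖w‖}` for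
`S = closedBall a (d/2) ∪ closedBall b (d/2)` (compact, contains `H⁻¹ a`); radial function
`ρ θ = 1 + min 1 (infDist (e^{iθ}) K / 2)` (continuous, `= 1` exactly on the directions of `K ∩ ∂𝔻`);
radial stretch `Ψ : ℂ ≃ₜ ℂ`, `Ψ (r e^{iθ}) = r ρ(θ) e^{iθ}`; `Φ := H ∘ Ψ ∘ H⁻¹`; `D' := D.map Φ`
(`MarkedDomain.map`: `D'.pt i = Φ (D.pt i) = D.pt i` since `ρ = 1` at the directions of `a, b`).  Then
`D ⊆ D'`, `D' ∖ closure D = H {1 < r < ρ θ}` misses `S`, and `∂D' = H(Ψ(∂𝔻))` is a compact set disjoint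
from the compact `closure D ∖ (ball a d ∪ ball b d)`, whence a uniform `ε`. [card socket-comparison; folklore] -/
def SocketedEnlargement : Prop :=
  ∀ (D : DobrushinDomain) (d : ℝ), 0 < d →
    ∃ (D' : DobrushinDomain) (ε : ℝ), 0 < ε ∧ D.carrier ⊆ D'.carrier ∧
      D'.pt 0 = D.pt 0 ∧ D'.pt 1 = D.pt 1 ∧
      D'.carrier ∩ (Metric.ball (D.pt 0) (d / 2) ∪ Metric.ball (D.pt 1) (d / 2)) ⊆ D.carrier ∧
      ∀ z ∈ closure D.carrier, d ≤ dist z (D.pt 0) → d ≤ dist z (D.pt 1) →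
        Metric.closedBall z ε ⊆ D'.carrier

/-- **Confinement positivity** (STUB E's statement; card socket-comparison's rate-free atom, typed on
the support-form confinement event of the landed restriction lemma `SAWRestrictionCovariance.lean`): for
Dobrushin domains `D' ⊆ D` with the same marked points which COINCIDE inside the two socket balls
`B(a, d) ∪ B(b, d)` (`D ∩ sockets ⊆ D'`), and lattice endpoints approximating the marked points in `D'`,
the critical SAW of the BIG domain `D` IS (the support of) a self-avoiding walk of the small discrete
domain `D'_δ` with probability `≥ c > 0` for all small `δ`.  Rate-free; `c, δ₀` per pair; predicted
value = the SLE₈⸝₃ restriction constant (LSW03); implied by `SAWScalingLimit` (portmanteau + restriction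
positivity: the obstacle `D ∖ D'` is `d`-far from `a, b`).  Honest status: an RSW-type LOWER bound at
`x_c` (none is known on `ℤ²` at any scale; DuminilCopinHammond2013 Question 2).  Under graph nesting the
event's law is EXACTLY `Z_{D'}(a_δ,b_δ) / Z_D(a_δ,b_δ)`.
[card socket-comparison; LawlerSchrammWerner2003Restriction; LawlerSchrammWerner2004SAW §3] -/
def ConfinementPositivity : Prop :=
  ∀ (D D' : DobrushinDomain) (a b : ℝ → Site 2) (d : ℝ), 0 < d →
    D'.carrier ⊆ D.carrier → D'.pt 0 = D.pt 0 → D'.pt 1 = D.pt 1 →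
    D.carrier ∩ (Metric.ball (D.pt 0) d ∪ Metric.ball (D.pt 1) d) ⊆ D'.carrier →
    SAW.IsEndpointApprox D' a b →
      ∃ c δ₀ : ℝ, 0 < c ∧ 0 < δ₀ ∧ ∀ δ ∈ Set.Ioc (0 : ℝ) δ₀,
        ENNReal.ofReal c ≤ SAW.law D.carrier δ (a δ) (b δ)
          {γ | ∃ γ' : SAW.DomainSAW D'.carrier δ (a δ) (b δ), γ'.walk.support = γ.walk.support}

/-- **The interior two-strand pinch bound** (STUB F's statement, HARDEST): for balls with a collar
inside the domain, `closedBall y (2R) ⊆ Ω`, radii `δ ≤ η < R ≤ R₀`, mesh `δ ≤ δ₀`: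
`P_δ[4 separate traversals of D(y; η, R)] ≤ C (η/R)^{1+s}`, constants depending on `(D, a, b)` only.
= Disproof §5 `ShellCrossingBoundBulk` with the threshold FIXED to `k₀ = 4` (its predicted minimal
admissible value; `k₀ ≤ 2` refuted, `Negative/BulkThresholdTwo.lean`) and the exponent demand LOWERED
from `> 2` to `> 1` (bulk prediction `x₄ = 35/12`, margin `1.9`; even two INDEPENDENT passages,
`2·x₂ = 4/3`, clear it).  Immune to boundary forcing (`Ω ∖ closedBall y R` is connected for a Jordan
`Ω`); the mesh clause `δ ≤ η` excludes sub-mesh junk.  No arm bound of any kind is proved for the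
planar SAW at `x_c` on any lattice (KS17 §4 omits SAW; DuminilCopinHammond2013) — the open content of the
line. [ideator 2 + Disproof §5] -/
def BulkTwoStrandPinch : Prop :=
  ∀ (D : DobrushinDomain) (a b : ℝ → Site 2), SAW.IsEndpointApprox D a b →
    ∃ (δ₀ C s R₀ : ℝ), 0 < δ₀ ∧ 0 < s ∧ 0 < R₀ ∧
      ∀ δ ∈ Set.Ioc (0 : ℝ) δ₀, ∀ (y : ℂ) (η R : ℝ),
        Metric.closedBall y (2 * R) ⊆ D.carrier → δ ≤ η → η < R → R ≤ R₀ →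
          SAW.law D.carrier δ (a δ) (b δ)
              {γ | (⟨γ.walk.toCurve (meshPoint δ)⟩ : Curve ℂ).HasTraversals 4 y η R} ≤
            ENNReal.ofReal (C * (η / R) ^ (1 + s))

/-- **Two-strand pinch bound away from the marked points, in the original domain, for every Dobrushin
domain with an endpoint approximation** — VERBATIM the registered S0 `stub_pinchAway` of line
`socket-comparison` (seat -0): for every `d > 0` there are `C, s > 0, R₀ > 0, δ₁ > 0` with
`P_δ[4 separate traversals of D(y; η, R)] ≤ C (η/R)^{1+s}` for `δ ≤ δ₁`, `δ ≤ η < R ≤ R₀` and centres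
`y` at distance `≥ d` from both marked points.  The conclusion of the socket transfer (STUB D) and the
hypothesis of the landed union bound `perShellDecay_of_pinchBound`. -/
def PinchAwayAll : Prop :=
  ∀ (D : DobrushinDomain) (a b : ℝ → Site 2), SAW.IsEndpointApprox D a b →
    ∀ d : ℝ, 0 < d → ∃ (C s R₀ δ₁ : ℝ), 0 < s ∧ 0 < R₀ ∧ 0 < δ₁ ∧
      ∀ δ ∈ Set.Ioc (0 : ℝ) δ₁, ∀ (y : ℂ) (η R : ℝ), δ ≤ η → η < R → R ≤ R₀ →
        d ≤ dist y (D.pt 0) → d ≤ dist y (D.pt 1) →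
          SAW.law D.carrier δ (a δ) (b δ)
              {γ | (⟨γ.walk.toCurve (meshPoint δ)⟩ : Curve ℂ).HasTraversals 4 y η R} ≤
            ENNReal.ofReal (C * (η / R) ^ (1 + s))

/-- Statement of the transfer stub (STUB D): enlargement + confinement + interior bound give the pinch
bound away from the marked points in every Dobrushin domain. -/
def SocketTransfer : Prop :=
  SocketedEnlargement → ConfinementPositivity → BulkTwoStrandPinch → PinchAwayAll

/-- **Per-shell decay of the traversal count** for one `(D, a, b)` (shell-dependent threshold AND
mesh bound; seat -0's `PerShellDecay`, conclusion of the landed `perShellDecay_of_pinchBound`). -/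
def PerShellDecay (D : DobrushinDomain) (a b : ℝ → Site 2) : Prop :=
  ∀ (x : ℂ) (ρ R : ℝ), 0 < ρ → ρ < R → ∀ ε : ℝ, 0 < ε → ∃ (k : ℕ) (δ₁ : ℝ), 0 < δ₁ ∧
    ∀ δ ∈ Set.Ioc (0 : ℝ) δ₁,
      SAW.law D.carrier δ (a δ) (b δ)
        {γ | (⟨γ.walk.toCurve (meshPoint δ)⟩ : Curve ℂ).HasTraversals k x ρ R} ≤ ENNReal.ofReal ε

/-! ## §1 The registered stubs (`sorry` lives ONLY in the OPEN ones — E, F of v-c1.1 and S0 of v-c2; tree vocabulary only) -/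

/-- **STUB C · `stub_socketedEnlargement`** (size L; CLOSED — LANDED p97679; plane topology) —
`= SocketedEnlargement` verbatim.  Construction in the docstring of `SocketedEnlargement`
(`JordanDomain.exists_homeomorph_eqOn_frontier` of `Literature/Topology/PlaneTopology/Schoenflies.lean`
applied to `JordanDomain.unitDisc` and `D`; radial stretch homeomorphism; `MarkedDomain.map` /
`pt_map` / `carrier_map` of `ChordalCurveFamily.lean`; compactness for `ε`). -/
theorem stub_socketedEnlargement :
    ∀ (D : DobrushinDomain) (d : ℝ), 0 < d →
      ∃ (D' : DobrushinDomain) (ε : ℝ), 0 < ε ∧ D.carrier ⊆ D'.carrier ∧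
        D'.pt 0 = D.pt 0 ∧ D'.pt 1 = D.pt 1 ∧
        D'.carrier ∩ (Metric.ball (D.pt 0) (d / 2) ∪ Metric.ball (D.pt 1) (d / 2)) ⊆ D.carrier ∧
        ∀ z ∈ closure D.carrier, d ≤ dist z (D.pt 0) → d ≤ dist z (D.pt 1) →
          Metric.closedBall z ε ⊆ D'.carrier :=
  -- CLOSED: LANDED p97679 (worker, wave 1) as `Theorems.stub_socketedEnlargement`,
  -- `Theorems/SAWRenewalTightnessShellCrossingBoundSocketedEnlargement.lean`.
  Theorems.stub_socketedEnlargement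

/-- **STUB D · `stub_socketTransfer`** (size M; CLOSED — LANDED p98857; restriction covariance on the lattice) —
`= SocketTransfer` with `SocketedEnlargement`, `ConfinementPositivity`, `BulkTwoStrandPinch`,
`PinchAwayAll` unfolded.  Proof: fix `D, a, b, hab, d`.
(1) `D̂ ⊇ D`, `ε`: sockets of radius `d/4`, room at distance `≥ d/2` (the enlargement at `d/2`).
(2) Nesting for `δ ≤ δ₃`: every `D_δ`-SAW `a_δ → b_δ` is, with the same support, a `D̂_δ`-SAW
(`Theorems.exists_domainSAW_of_meshDomain_subset` of `…ShellCrossingBoundSocketNesting.lean` once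
`meshDomain D δ ⊆ meshDomain D̂ δ`, which holds for small `δ` by
`JordanDomain.exists_forall_mem_meshDomain_and_reachable` for `D` and for `D̂` with a small closed disc
`K ⊆ D`, `Theorems.reachable_meshVertexGraph_mono` and `mem_meshDomain_of_reachable_meshVertexGraph`);
hence `SAW.IsEndpointApprox D̂ a b` (same marked points; reachability transfers along the nesting).
(3) `BulkTwoStrandPinch D̂ a b` gives `δ₁, C, s, R₁`; `ConfinementPositivity D̂ D a b (d/4)` gives `c, δ₂`.
(4) `δ₀ := min δ₁ (min δ₂ δ₃)`, `R₀ := min R₁ (min (ε/3) (d/4))`, constant `C/c`.  For `δ ≤ δ₀`, `y` at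
distance `≥ d` from the marked points, `δ ≤ η < R ≤ R₀`: if no point of `closure D` is within `η` of `y`
the event is EMPTY (a traversal of a genuine shell needs a non-constant polyline with a point in
`closedBall y η`, and the polyline of a non-nil walk of `D_δ` lies in `closure D`: vertices in `D`,
edges `⊆ closure D` by `meshGraph_adj_iff`; the nil walk is a constant curve and traverses nothing),
mass `0`.  Otherwise pick `z ∈ closure D`, `dist y z ≤ η ≤ d/4`, so `dist z (pt i) ≥ d/2` and
`closedBall y (2R) ⊆ closedBall z (3R₀) ⊆ closedBall z ε ⊆ D̂`: the ball is INTERIOR in `D̂`.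
(5) Restriction covariance (LANDED, `SAW.law_mul_law_setOf_exists_support_eq_le` with the nesting of
(2) and `E = {c | c.HasTraversals 4 y η R}`): `law D E · law D̂ (Conf D) ≤ law D̂ E ≤ C (η/R)^{1+s}`,
and `ofReal c ≤ law D̂ (Conf D)`; divide (`ENNReal.le_div_iff_mul_le`, `ENNReal.ofReal_div_of_pos`). -/
theorem stub_socketTransfer :
    (∀ (D : DobrushinDomain) (d : ℝ), 0 < d →
      ∃ (D' : DobrushinDomain) (ε : ℝ), 0 < ε ∧ D.carrier ⊆ D'.carrier ∧
        D'.pt 0 = D.pt 0 ∧ D'.pt 1 = D.pt 1 ∧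
        D'.carrier ∩ (Metric.ball (D.pt 0) (d / 2) ∪ Metric.ball (D.pt 1) (d / 2)) ⊆ D.carrier ∧
        ∀ z ∈ closure D.carrier, d ≤ dist z (D.pt 0) → d ≤ dist z (D.pt 1) →
          Metric.closedBall z ε ⊆ D'.carrier) →
    (∀ (D D' : DobrushinDomain) (a b : ℝ → Site 2) (d : ℝ), 0 < d →
      D'.carrier ⊆ D.carrier → D'.pt 0 = D.pt 0 → D'.pt 1 = D.pt 1 →
      D.carrier ∩ (Metric.ball (D.pt 0) d ∪ Metric.ball (D.pt 1) d) ⊆ D'.carrier →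
      SAW.IsEndpointApprox D' a b →
        ∃ c δ₀ : ℝ, 0 < c ∧ 0 < δ₀ ∧ ∀ δ ∈ Set.Ioc (0 : ℝ) δ₀,
          ENNReal.ofReal c ≤ SAW.law D.carrier δ (a δ) (b δ)
            {γ | ∃ γ' : SAW.DomainSAW D'.carrier δ (a δ) (b δ),
              γ'.walk.support = γ.walk.support}) →
    (∀ (D : DobrushinDomain) (a b : ℝ → Site 2), SAW.IsEndpointApprox D a b →
      ∃ (δ₀ C s R₀ : ℝ), 0 < δ₀ ∧ 0 < s ∧ 0 < R₀ ∧
        ∀ δ ∈ Set.Ioc (0 : ℝ) δ₀, ∀ (y : ℂ) (η R : ℝ),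
          Metric.closedBall y (2 * R) ⊆ D.carrier → δ ≤ η → η < R → R ≤ R₀ →
            SAW.law D.carrier δ (a δ) (b δ)
                {γ | (⟨γ.walk.toCurve (meshPoint δ)⟩ : Curve ℂ).HasTraversals 4 y η R} ≤
              ENNReal.ofReal (C * (η / R) ^ (1 + s))) →
    ∀ (D : DobrushinDomain) (a b : ℝ → Site 2), SAW.IsEndpointApprox D a b →
      ∀ d : ℝ, 0 < d → ∃ (C s R₀ δ₁ : ℝ), 0 < s ∧ 0 < R₀ ∧ 0 < δ₁ ∧
        ∀ δ ∈ Set.Ioc (0 : ℝ) δ₁, ∀ (y : ℂ) (η R : ℝ), δ ≤ η → η < R → R ≤ R₀ →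
          d ≤ dist y (D.pt 0) → d ≤ dist y (D.pt 1) →
            SAW.law D.carrier δ (a δ) (b δ)
                {γ | (⟨γ.walk.toCurve (meshPoint δ)⟩ : Curve ℂ).HasTraversals 4 y η R} ≤
              ENNReal.ofReal (C * (η / R) ^ (1 + s)) :=
  -- CLOSED: LANDED p98857 (worker, wave 1) as `Theorems.stub_socketTransfer`,
  -- `Theorems/SAWRenewalTightnessShellCrossingBoundSocketTransfer.lean`.
  Theorems.stub_socketTransfer

/-- **STUB E · `stub_confinementPositivity`** (size L–XL, OPEN; rate-free RSW-type lower bound at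
`x_c`) — `= ConfinementPositivity` verbatim.  Why plausibly true: the sockets keep the boundary germs at
`a, b` identical, so `Z_{D'}(a_δ,b_δ)/Z_D(a_δ,b_δ)` is of order one and predicted to converge to the
SLE₈⸝₃ restriction probability `P[γ ∩ (D ∖ D') = ∅] > 0` (LSW03); implied by `SAWScalingLimit`; band
test of the crux's own measure `0.44 / 0.40 / 0.28–0.32` at meshes `1/16, 1/32, 1/64` vs the conformal
prediction `0.332` (ToyDataIdeator2.md); PERM `Z_D/Z_Ω = 0.70, 0.60, 0.59, 0.74` at `δ = 1/8 … 1/64`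
for the socketed disc (kit j012789).  Why it might fail: it IS a lower bound on a constrained critical
partition function, and none is known on `ℤ²` at any scale (DuminilCopinHammond2013 Question 2);
without sockets it is false (power decay in `δ`). -/
theorem stub_confinementPositivity :
    ∀ (D D' : DobrushinDomain) (a b : ℝ → Site 2) (d : ℝ), 0 < d →
      D'.carrier ⊆ D.carrier → D'.pt 0 = D.pt 0 → D'.pt 1 = D.pt 1 →
      D.carrier ∩ (Metric.ball (D.pt 0) d ∪ Metric.ball (D.pt 1) d) ⊆ D'.carrier →
      SAW.IsEndpointApprox D' a b →
        ∃ c δ₀ : ℝ, 0 < c ∧ 0 < δ₀ ∧ ∀ δ ∈ Set.Ioc (0 : ℝ) δ₀,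
          ENNReal.ofReal c ≤ SAW.law D.carrier δ (a δ) (b δ)
            {γ | ∃ γ' : SAW.DomainSAW D'.carrier δ (a δ) (b δ),
              γ'.walk.support = γ.walk.support} := by
  sorry

/-- **STUB F · `stub_bulkTwoStrandPinch`** (size XL, OPEN — the HARDEST stub, held by the lead; the
interior two-pinch / 4-leg bound with exponent `> 1` for the critical `ℤ²` SAW) — `= BulkTwoStrandPinch`
verbatim.  Why plausibly true: bulk watermelon exponent `x₄ = 35/12 ≫ 1`, and even two independent
passages (`2x₂ = 4/3`) clear the threshold; BFACF slope `2.56` at mesh `1/64`.  Why it might fail: no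
arm bound of any kind is proved for the planar SAW at `x_c` (KS17 §4 omits SAW; DC–Hammond give
sub-ballisticity only; even `G_{x_c}(e₁) < ∞` is open on `ℤ²`), and the constant must be uniform over
the position of the ball in the domain.  Engines on file (card pinch-on-a-circle §Transfer; not part
of the registered statement): (a) decoupling `P[two passes] ≤ P[pass] · sup' P[pass | first strand]`;
(b) two-sided `x_c`-Gibbs resampling inside `B(y, 2R)`; (c) the route's surgery with one excision pair
per strand (r3 `AnnularMassDecay`, r4 `TubeLowerBound`) — each needs a gluing LOWER bound for
constrained critical SAW partition functions, uniform in the mesh, which is the missing theory. -/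
theorem stub_bulkTwoStrandPinch :
    ∀ (D : DobrushinDomain) (a b : ℝ → Site 2), SAW.IsEndpointApprox D a b →
      ∃ (δ₀ C s R₀ : ℝ), 0 < δ₀ ∧ 0 < s ∧ 0 < R₀ ∧
        ∀ δ ∈ Set.Ioc (0 : ℝ) δ₀, ∀ (y : ℂ) (η R : ℝ),
          Metric.closedBall y (2 * R) ⊆ D.carrier → δ ≤ η → η < R → R ≤ R₀ →
            SAW.law D.carrier δ (a δ) (b δ)
                {γ | (⟨γ.walk.toCurve (meshPoint δ)⟩ : Curve ℂ).HasTraversals 4 y η R} ≤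
              ENNReal.ofReal (C * (η / R) ^ (1 + s)) := by
  sorry

/-- **STUB S0 · `stub_pinchAway`** (size XL, OPEN — the ONE open stub of reshape v-c2, held by the
lead; registered additively 2026-08-16 by seat c2-0, text = seat -0's expired S0 verbatim =
`PinchAwayAll`) — the two-strand pinch bound AWAY FROM THE MARKED POINTS in the original domain: for
every `d > 0`, `P_δ[4 separate traversals of D(y; η, R)] ≤ C (η/R)^{1+s}` for `δ ≤ δ₁`,
`δ ≤ η < R ≤ R₀`, centres `y` at distance `≥ d` from both marked points.  A FIXED-THRESHOLD arm
estimate for the critical `ℤ²` SAW with any exponent above `1`; immune to every standing witness of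
`Disproof.lean` (uniform-threshold forcing sits AT the marked point; the `k₀ ≤ 2` interior-endpoint
witness needs threshold `≤ 2` and is absorbed by `C(d)`; sub-mesh junk excluded by `δ ≤ η`).  Why
plausibly true: watermelon exponents `x₄ = 35/12` (bulk), `7` (flat boundary), all `> 1`; BFACF slope
`2.2–3.0`.  Why crux-sized: no arm/pinch bound of any kind is proved for the planar SAW at `x_c` on any
lattice; virgin-disc reconnection loses `r^{25/24}` (`r = η/δ`) between bulk and disc-boundary
normalisations; excision multiplicity is the rooted `x_c`-loop mass (finiteness ⟸ `p_n ≤ n^{-2-κ}μ^n`,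
beyond Hammond's `3/2`); no BK inequality for strands of one SAW.  Two LANDED descents:
`S0 ⇐ E ∧ F` (`pinchAwayAll_of_EF` below = `Theorems.stub_socketTransfer` ∘ `stub_socketedEnlargement`)
and `S0 ⇐ S4 ∧ S5` (seat -0, `Lines/socket_comparison.lean`, S2 p86740 + S3 p88835). -/
theorem stub_pinchAway :
    ∀ (D : DobrushinDomain) (a b : ℝ → Site 2), SAW.IsEndpointApprox D a b →
      ∀ d : ℝ, 0 < d → ∃ (C s R₀ δ₁ : ℝ), 0 < s ∧ 0 < R₀ ∧ 0 < δ₁ ∧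
        ∀ δ ∈ Set.Ioc (0 : ℝ) δ₁, ∀ (y : ℂ) (η R : ℝ), δ ≤ η → η < R → R ≤ R₀ →
          d ≤ dist y (D.pt 0) → d ≤ dist y (D.pt 1) →
            SAW.law D.carrier δ (a δ) (b δ)
                {γ | (⟨γ.walk.toCurve (meshPoint δ)⟩ : Curve ℂ).HasTraversals 4 y η R} ≤
              ENNReal.ofReal (C * (η / R) ^ (1 + s)) := by
  sorry

/-! ### Consistency: each named statement IS its registered stub (definitionally) -/

/-- `SocketedEnlargement` is STUB C, verbatim. -/
theorem socketedEnlargement_holds : SocketedEnlargement := stub_socketedEnlargement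
/-- `SocketTransfer` is STUB D, by unfolding the four named statements. -/
theorem socketTransfer_holds : SocketTransfer := stub_socketTransfer
/-- `ConfinementPositivity` is STUB E, verbatim. -/
theorem confinementPositivity_holds : ConfinementPositivity := stub_confinementPositivity
/-- `BulkTwoStrandPinch` is STUB F, verbatim. -/
theorem bulkTwoStrandPinch_holds : BulkTwoStrandPinch := stub_bulkTwoStrandPinch
/-- `PinchAwayAll` is STUB S0, verbatim. -/
theorem pinchAwayAll_holds : PinchAwayAll := stub_pinchAway

/-- **The landed descent `S0 ⇐ E ∧ F`** (sub-line of v-c2 = the composition of v-c1.1): confinement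
positivity and the interior two-strand pinch bound give `PinchAwayAll`, by the LANDED socket transfer
fed with the LANDED socketed enlargement.  No `sorry` is used here beyond the hypotheses. -/
theorem pinchAwayAll_of_EF (hE : ConfinementPositivity) (hF : BulkTwoStrandPinch) : PinchAwayAll :=
  socketTransfer_holds socketedEnlargement_holds hE hF

/-! ### Name-keyed aliases of the statements (the hypotheses of the compositions) -/
namespace Registered

/-- Alias of `SocketedEnlargement` keyed by the registered stub name. -/
abbrev stub_socketedEnlargement : Prop := SocketedEnlargement
/-- Alias of `SocketTransfer` keyed by the registered stub name. -/
abbrev stub_socketTransfer : Prop := SocketTransfer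
/-- Alias of `ConfinementPositivity` keyed by the registered stub name. -/
abbrev stub_confinementPositivity : Prop := ConfinementPositivity
/-- Alias of `BulkTwoStrandPinch` keyed by the registered stub name. -/
abbrev stub_bulkTwoStrandPinch : Prop := BulkTwoStrandPinch
/-- Alias of `PinchAwayAll` keyed by the registered stub name (S0, reshape v-c2). -/
abbrev stub_pinchAway : Prop := PinchAwayAll

end Registered

/-! ## §2 Proved glue (no `sorry`): `PinchAwayAll` ⟹ per-shell decay ⟹ the crux's bound -/

/-- **Landed union bound, instantiated**: the pinch bound away from the marked points gives per-shell
decay of the traversal count for every `(D, a, b)` with an endpoint approximation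
(`perShellDecay_of_pinchBound`, Literature `PinchUnionBound.lean`, with the critical SAW laws, the SAW
polylines and the two marked points). -/
theorem pinchAwayAll_perShellDecay (hPA : PinchAwayAll) (D : DobrushinDomain) (a b : ℝ → Site 2)
    (hab : SAW.IsEndpointApprox D a b) : PerShellDecay D a b := by
  intro x ρ R hρ hρR ε hε
  exact perShellDecay_of_pinchBound (α := fun δ => SAW.DomainSAW D.carrier δ (a δ) (b δ))
    (fun δ => SAW.law D.carrier δ (a δ) (b δ))
    (fun δ γ => (⟨γ.walk.toCurve (meshPoint δ)⟩ : Curve ℂ)) (D.pt 0) (D.pt 1) (hPA D a b hab) x hρ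
    hρR hε

/-- **Per-shell decay + coarse-mesh counting ⟹ the crux's bound** for one `(D, a, b)`, with `K = 1`,
`λ = 3` and the GLOBAL mesh threshold `δ₀ = 1`: for a genuine shell take `ε = (ρ/R)^3`, the `k₁, δ₁` of
per-shell decay and the `N` of the LANDED coarse-mesh count `Theorems.stub_travCount` (p81647) at
`(ρ, δ₁)`; the threshold `max k₁ N` works for `δ ≤ δ₁` by monotonicity in `k` and for `δ > δ₁` because
the event is empty.  (Re-proof of seat -0's `bound_of_perShellDecay`, `Lines/socket_comparison.lean`.) -/
theorem bound_of_perShellDecay (D : DobrushinDomain) (a b : ℝ → Site 2) (hP : PerShellDecay D a b) :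
    ∃ (k : ℂ → ℝ → ℝ → ℕ) (K lam δ₀ : ℝ), 2 < lam ∧ 0 < δ₀ ∧ ∀ δ ∈ Set.Ioc (0 : ℝ) δ₀,
      ∀ (x : ℂ) (ρ R : ℝ), δ ≤ ρ → ρ < R → R ≤ 1 →
        SAW.law D.carrier δ (a δ) (b δ)
            {γ | (⟨γ.walk.toCurve (meshPoint δ)⟩ : Curve ℂ).HasTraversals (k x ρ R) x ρ R} ≤
          ENNReal.ofReal (K * (ρ / R) ^ lam) := by
  classical
  have key : ∀ (x : ℂ) (ρ R : ℝ), ∃ k : ℕ, 0 < ρ → ρ < R → ∀ δ ∈ Set.Ioc (0 : ℝ) 1,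
      SAW.law D.carrier δ (a δ) (b δ)
          {γ | (⟨γ.walk.toCurve (meshPoint δ)⟩ : Curve ℂ).HasTraversals k x ρ R} ≤
        ENNReal.ofReal ((ρ / R) ^ (3 : ℝ)) := by
    intro x ρ R
    by_cases h : 0 < ρ ∧ ρ < R
    · have hε : 0 < (ρ / R) ^ (3 : ℝ) := Real.rpow_pos_of_pos (div_pos h.1 (h.1.trans h.2)) _
      obtain ⟨k₁, δ₁, hδ₁, hk₁⟩ := hP x ρ R h.1 h.2 _ hε
      obtain ⟨N, hN⟩ := Theorems.stub_travCount ρ δ₁ h.1 hδ₁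
      refine ⟨max k₁ N, fun _ _ δ hδ => ?_⟩
      by_cases hle : δ ≤ δ₁
      · calc SAW.law D.carrier δ (a δ) (b δ)
              {γ | (⟨γ.walk.toCurve (meshPoint δ)⟩ : Curve ℂ).HasTraversals (max k₁ N) x ρ R}
            ≤ SAW.law D.carrier δ (a δ) (b δ)
              {γ | (⟨γ.walk.toCurve (meshPoint δ)⟩ : Curve ℂ).HasTraversals k₁ x ρ R} :=
              measure_mono fun γ hγ => Curve.HasTraversals.of_le hγ (le_max_left _ _)
          _ ≤ ENNReal.ofReal ((ρ / R) ^ (3 : ℝ)) := hk₁ δ ⟨hδ.1, hle⟩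
      · have hempty :
            {γ : SAW.DomainSAW D.carrier δ (a δ) (b δ) |
              (⟨γ.walk.toCurve (meshPoint δ)⟩ : Curve ℂ).HasTraversals (max k₁ N) x ρ R} = ∅ :=
          Set.eq_empty_iff_forall_notMem.2 fun γ hγ =>
            hN D.carrier δ (a δ) (b δ) γ x R (le_of_lt (not_le.1 hle)) h.2
              (Curve.HasTraversals.of_le hγ (le_max_right _ _))
        rw [hempty, measure_empty]
        exact bot_le
    · exact ⟨0, fun h1' h2' => absurd ⟨h1', h2'⟩ h⟩
  choose k hk using key
  refine ⟨k, 1, 3, 1, by norm_num, one_pos, fun δ hδ x ρ R hδρ hρR _ => ?_⟩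
  rw [one_mul]
  exact hk x ρ R (hδ.1.trans_le hδρ) hρR δ hδ

/-! ## §3 The composition: the ONE open stub S0 implies the crux, BY NAME (kernel-checked; no `sorry` below) -/

/-- **`ShellCrossingBound_of`** — the composition of reshape v-c2: the single open registered stub S0
(`stub_pinchAway` = `PinchAwayAll`) implies the crux `SAWRenewalTightness.ShellCrossingBound` by name —
per-shell decay by the landed union bound ⟹ the crux's bound by the landed coarse-mesh count; `K = 1`,
`λ = 3`, `δ₀ = 1`.  Everything below S0 is kernel-checked and in the tree; the same implication with the
S0 text unfolded is the landed `Theorems.shellCrossingBound_of_pinchAway` (p107371). -/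
theorem ShellCrossingBound_of (hS0 : Registered.stub_pinchAway) :
    Summit.CriticalPhenomena.SAWScalingLimit.Theses.SAWRenewalTightness.ShellCrossingBound :=
  fun D a b hab => bound_of_perShellDecay D a b (pinchAwayAll_perShellDecay hS0 D a b hab)

/-- The composition of reshape v-c1.1 (co-lead c1-0), kept as the SUB-LINE through the landed descent
`S0 ⇐ E ∧ F`: the two open registered stubs E (`stub_confinementPositivity`, rate-free) and F
(`stub_bulkTwoStrandPinch`, the interior two-strand pinch bound) imply the crux by name. -/
theorem ShellCrossingBound_of_EF (hE : Registered.stub_confinementPositivity)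
    (hF : Registered.stub_bulkTwoStrandPinch) :
    Summit.CriticalPhenomena.SAWScalingLimit.Theses.SAWRenewalTightness.ShellCrossingBound :=
  ShellCrossingBound_of (pinchAwayAll_of_EF hE hF)

/-- The composition with all FOUR v-c1 stubs as hypotheses (the shape registered by c1-0 at pick time;
kept for the record — C and D are theorems). -/
theorem ShellCrossingBound_of_CDEF (hC : Registered.stub_socketedEnlargement)
    (hD : Registered.stub_socketTransfer) (hE : Registered.stub_confinementPositivity)
    (hF : Registered.stub_bulkTwoStrandPinch) :
    Summit.CriticalPhenomena.SAWScalingLimit.Theses.SAWRenewalTightness.ShellCrossingBound :=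
  ShellCrossingBound_of (hD hC hE hF)

/-- Wiring check: the one open registered stub feeds `ShellCrossingBound_of` as stated. -/
example : Summit.CriticalPhenomena.SAWScalingLimit.Theses.SAWRenewalTightness.ShellCrossingBound :=
  ShellCrossingBound_of stub_pinchAway

/-- Wiring check of the sub-line: E ∧ F feed `ShellCrossingBound_of_EF` as stated. -/
example : Summit.CriticalPhenomena.SAWScalingLimit.Theses.SAWRenewalTightness.ShellCrossingBound :=
  ShellCrossingBound_of_EF stub_confinementPositivity stub_bulkTwoStrandPinch

/-! ## §4 Negative knowledge checked against (landed `Theorems/ShellCrossingBound/Negative/*`) -/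

/-- The refuted UNIFORM-threshold statement (one `k` for all shells, incl. those at the marked
point): recorded so that no stub drifts into an instance of it — `BulkTwoStrandPinch` fixes `k = 4`
only on balls with a collar inside `Ω`, `PinchAwayAll` only `d`-away from the marked points. -/
example : ¬ (∀ (D : DobrushinDomain) (a b : ℝ → Site 2), SAW.IsEndpointApprox D a b →
    ∃ (k : ℕ) (K lam δ₀ : ℝ), 2 < lam ∧ 0 < δ₀ ∧ ∀ δ ∈ Set.Ioc (0 : ℝ) δ₀,
      ∀ (x : ℂ) (ρ R : ℝ), δ ≤ ρ → ρ < R → R ≤ 1 →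
        SAW.law D.carrier δ (a δ) (b δ)
          {γ | (⟨γ.walk.toCurve (meshPoint δ)⟩ : Curve ℂ).HasTraversals k x ρ R}
            ≤ ENNReal.ofReal (K * (ρ / R) ^ lam)) :=
  Theorems.ShellCrossingBound.Negative.not_uniformThreshold

/-- Calibration (landed): the target already implies the crux — the line's content is the FIXED
threshold `4` of STUB F, which tightness does not give. -/
example (hT : Theses.SAWRenewalTightness.EventualTight) : ShellCrossingBound := by
  intro D a b hab
  obtain ⟨δ₀, hδ₀, htight⟩ := hT D a b hab
  obtain ⟨k, hk⟩ :=
    Theorems.ShellCrossingBound.Negative.bound_of_isTightMeasureSet D a b _ htight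
  exact ⟨k, 1, 3, δ₀, by norm_num, hδ₀, fun δ hδ x ρ R hδρ hρR _ =>
    hk δ hδ x ρ R (hδ.1.trans_le hδρ) hρR⟩

end Summit.CriticalPhenomena.SAWScalingLimit.Cruxes.ShellCrossingBound.PinchOnACircle

end
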